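import Summits.NavierStokesRegularity.NavierStokesRegularity.Theorems.EfficiencyFloorNearMaximiserBoundedAmplificationSubwindow
import HarnessLib

/-!
# Route `EfficiencyFloor`, bet node `NearMaximiserBoundedAmplification` (stmt-NavierStokesRegularity-25483, part 3/4 of the
# `LerayFloorGap` rung 25164 under the crux `ProductionEfficiencyDecay` 22866): the item is EQUIVALENT to a
# ONE-INSTANT «early deficit» law — the `A⁻²` sliver is decided strictly inside the would-be blow-up window

Helper file (`--supports stmt-NavierStokesRegularity-25483`). The item asks for `A ≥ 1`, `ε > 0` such that along every
maximal classical Leray–Hopf rapidly-decaying-datum solution, whenever a slice `u(s)` is `ε`-close (scale-free `Ḣ¹∩Ḣ²`) to a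
normalised maximiser `m`, `Z(u(t)) ≤ A·Z(u(s))` on the WHOLE would-be blow-up window `t − s ≤ W(s) := (64ν³/(27c⋆⁴))·Z(u(s))⁻²`
(`Z(v) = ∫‖curl v‖²`; `W(s)` is the blow-up time of the comparison ODE `Ż = (27c⋆⁴/(128ν³))Z³`). The landed
`…Subwindow` file gives the bound for free on every proper initial fraction of the window; the open content sits in the last
`A⁻²`-fraction, where the comparison solution is unbounded.

WHAT IS PROVED HERE (unconditional; real analysis on the landed sharp cubic law `SharpLuDoeringBudget` stmt-25481, the landed
`BlowupEnstrophyUnbounded` stmt-22867 and Leray's floor):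

* `sq_le_of_earlyDeficit` (real analysis) — if `Z > 0` obeys `Ż ≤ KZ³` on `[t₁,T)` and at the single instant
  `s' = s + η·(2K)⁻¹Z(s)⁻²` (`0 ≤ η < 1`) the inverse-square enstrophy exceeds its comparison value by a margin,
  `Z(s')⁻² ≥ (1 − η + 2θ)·Z(s)⁻²` (`θ > 0`), then `Z(t)² ≤ max((1−η)⁻¹, (2θ)⁻¹)·Z(s)²` on the WHOLE window
  `t − s ≤ (2K)⁻¹Z(s)⁻²`: after `s'` the cubic law can consume at most the remaining `(1−η)Z(s)⁻²`, leaving `2θZ(s)⁻²`.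
* `lintegral_curl_sq_pos` — the enstrophy of a maximal classical Leray–Hopf rapidly-decaying-datum solution is positive at EVERY
  `t ∈ [0,T)` (Leray's floor `leray_blowup_rate_enstrophy` + `∫|∇u|²_F ≤ ∫|curl u|²`), so the cubic law integrates from any
  slice time `s ∈ (0,T)`, not only on a late window.
* `sharp_const_unique` — the sharp one-sided Lu–Doering constant of the route decls is unique (so the budget of stmt-25481
  serves every `c` the item quantifies over).
* **`nearMaximiserBoundedAmplification_iff_earlyDeficit`** (BY NAME against the route decl) —
  `Theses.EfficiencyFloor.NearMaximiserBoundedAmplification` holds IFF the EARLY-DEFICIT LAW holds: there are `0 ≤ η < 1`,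
  `θ > 0`, `ε > 0` such that along every such solution, whenever `u(s)` (`0 < s < T`) is `ε`-close to a normalised maximiser,
  the instant `s' = s + η·W(s)` lies before `T` and `Z(u(s'))⁻² ≥ (1 − η + 2θ)·Z(u(s))⁻²` — i.e. by the time the fixed
  fraction `η` of the would-be blow-up window has elapsed, the enstrophy is STRICTLY below the comparison value
  `Z(u(s))/√(1−η)` by a fixed relative margin. (`→`: `η = 1 − A⁻²/2`, `θ = A⁻²/4`, window survival `s + W(s) < T` from
  `BlowupEnstrophyUnbounded`; `←`: `A = √max((1−η)⁻¹,(2θ)⁻¹)`.)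

READING (what this changes in the census of stmt-25483 / `RigidExit` stmt-25513). The dynamical content of the bet node is a
SINGLE-INSTANT inequality at an interior time `s + ηW(s)` of the window, NOT a uniform bound up to the window's end: a
continuous-dependence argument around a maximiser's own evolution is needed only on the closed interval `[0, η·W]`, strictly
inside the comparison window where that evolution is classical with bounded norms a priori (no separate «bounded amplification of
the maximiser on the CLOSED window `[0,W]`» step), and the numerical instrument row is one number per run
(`Z(s+ηW)²·(1−η)/Z(s)² < 1 − margin`). HONEST FRAMING: an equivalence of two OPEN statements about a HYPOTHETICAL blow-up;
stmt-25483, `RigidExit`, `LerayFloorGap`, `ProductionEfficiencyDecay` and Navier–Stokes regularity stay OPEN; no summit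
statement is proved. [folklore]
-/

-- the problem directory repeats the summit name (`NavierStokesRegularity/NavierStokesRegularity`)
set_option linter.dupNamespace false

noncomputable section

namespace Summit.NavierStokesRegularity.NavierStokesRegularity.Theorems

namespace NearMaximiserBoundedAmplification

open Set MeasureTheory Filter Topology Function
open scoped InnerProductSpace ENNReal
open Literature.Analysis.FluidPDE
open Summit.NavierStokesRegularity.NavierStokesRegularity.Theorems.ProductionEfficiencyDecay

/-! ## Real analysis: the early-deficit form of the `A⁻²` sliver -/

/-- From `a·x⁻² ≤ y⁻²` with `a, x, y > 0` to `y² ≤ a⁻¹·x²`. [folklore] -/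
theorem sq_le_of_le_inv_sq {a x y : ℝ} (ha : 0 < a) (hx : 0 < x) (hy : 0 < y)
    (h : a * x⁻¹ ^ 2 ≤ y⁻¹ ^ 2) : y ^ 2 ≤ a⁻¹ * x ^ 2 := by
  have hx2 : 0 < x ^ 2 := by positivity
  have hy2 : 0 < y ^ 2 := by positivity
  rw [inv_pow, inv_pow] at h
  have h' : a / x ^ 2 ≤ 1 / y ^ 2 := by rwa [div_eq_mul_inv, one_div]
  rw [div_le_div_iff₀ hx2 hy2, one_mul] at h'
  rw [← div_eq_inv_mul, le_div_iff₀ ha]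
  linarith

/-- **Early deficit ⇒ bounded amplification on the whole window.** Let `Z > 0` on `[t₁,T)` have at every point a
derivative `≤ K·Z³` (`K > 0`), let `t₁ ≤ s`, `0 ≤ η < 1`, `θ > 0`, and suppose that the instant
`s' = s + η·(2K)⁻¹·Z(s)⁻²` carries the margin `(1 − η + 2θ)·Z(s)⁻² ≤ Z(s')⁻²`. Then for every
`t ∈ [s,T)` with `t − s ≤ (2K)⁻¹·Z(s)⁻²`: `Z(t)² ≤ max((1−η)⁻¹, (2θ)⁻¹)·Z(s)²`. [folklore] -/
theorem sq_le_of_earlyDeficit {Zr : ℝ → ℝ} {t₁ T K η θ : ℝ} (hK : 0 < K) (hη0 : 0 ≤ η) (hη1 : η < 1)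
    (hθ : 0 < θ) (hpos : ∀ t ∈ Ico t₁ T, 0 < Zr t)
    (hder : ∀ t ∈ Ico t₁ T, ∃ D : ℝ, HasDerivAt Zr D t ∧ D ≤ K * Zr t ^ 3)
    {s : ℝ} (hs : t₁ ≤ s)
    (hdef : (1 - η + 2 * θ) * (Zr s)⁻¹ ^ 2 ≤ (Zr (s + η * ((2 * K)⁻¹ * (Zr s)⁻¹ ^ 2)))⁻¹ ^ 2)
    {t : ℝ} (hst : s ≤ t) (htT : t < T) (hwin : t - s ≤ (2 * K)⁻¹ * (Zr s)⁻¹ ^ 2) :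
    Zr t ^ 2 ≤ max (1 - η)⁻¹ (2 * θ)⁻¹ * Zr s ^ 2 := by
  set W : ℝ := (2 * K)⁻¹ * (Zr s)⁻¹ ^ 2 with hW
  set s' : ℝ := s + η * W with hs'
  have hsT : s < T := lt_of_le_of_lt hst htT
  have hZs : 0 < Zr s := hpos s ⟨hs, hsT⟩
  have hZt : 0 < Zr t := hpos t ⟨hs.trans hst, htT⟩
  have hW0 : 0 ≤ W := by positivity
  have h2KW : 2 * K * W = (Zr s)⁻¹ ^ 2 := by
    rw [hW, ← mul_assoc, mul_inv_cancel₀ (by positivity), one_mul]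
  have h1η : 0 < 1 - η := by linarith
  have hZs2 : 0 ≤ Zr s ^ 2 := sq_nonneg _
  rcases le_or_gt t s' with hts' | hts'
  · -- initial fraction of the window: the free comparison bound
    have hint := stub_integrateEfficiency Zr t₁ T K hpos hder s t hs hst htT
    have h0 : t - s ≤ η * W := by rw [hs'] at hts'; linarith
    have h1 : 2 * K * (t - s) ≤ η * (Zr s)⁻¹ ^ 2 :=
      calc 2 * K * (t - s) ≤ 2 * K * (η * W) := mul_le_mul_of_nonneg_left h0 (by positivity)
        _ = η * (2 * K * W) := by ring
        _ = η * (Zr s)⁻¹ ^ 2 := by rw [h2KW]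
    have h2 : (1 - η) * (Zr s)⁻¹ ^ 2 ≤ (Zr t)⁻¹ ^ 2 := by linarith
    calc Zr t ^ 2 ≤ (1 - η)⁻¹ * Zr s ^ 2 := sq_le_of_le_inv_sq h1η hZs hZt h2
      _ ≤ max (1 - η)⁻¹ (2 * θ)⁻¹ * Zr s ^ 2 := mul_le_mul_of_nonneg_right (le_max_left _ _) hZs2
  · -- after the early-deficit instant `s'`: integrate the cubic law from `s'`
    have hss' : s ≤ s' := by rw [hs']; nlinarith
    have hint := stub_integrateEfficiency Zr t₁ T K hpos hder s' t (hs.trans hss') hts'.le htT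
    have h0 : t - s' ≤ (1 - η) * W := by rw [hs']; linarith
    have h1 : 2 * K * (t - s') ≤ (1 - η) * (Zr s)⁻¹ ^ 2 :=
      calc 2 * K * (t - s') ≤ 2 * K * ((1 - η) * W) := mul_le_mul_of_nonneg_left h0 (by positivity)
        _ = (1 - η) * (2 * K * W) := by ring
        _ = (1 - η) * (Zr s)⁻¹ ^ 2 := by rw [h2KW]
    have h2 : (2 * θ) * (Zr s)⁻¹ ^ 2 ≤ (Zr t)⁻¹ ^ 2 := by linarith
    have h2θ : 0 < 2 * θ := by positivity
    calc Zr t ^ 2 ≤ (2 * θ)⁻¹ * Zr s ^ 2 := sq_le_of_le_inv_sq h2θ hZs hZt h2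
      _ ≤ max (1 - η)⁻¹ (2 * θ)⁻¹ * Zr s ^ 2 := mul_le_mul_of_nonneg_right (le_max_right _ _) hZs2

/-! ## Two bookkeeping facts about the route's objects -/

/-- **Enstrophy is positive at every time of a maximal solution.** Along a maximal classical solution on `[0,T)` that is
Leray–Hopf from a rapidly decaying datum, `0 < ∫⁻‖curl u(t)‖ₑ²` for every `t ∈ [0,T)`: Leray's floor
`c ν^{3/2}(T−t)^{−1/2} ≤ ∫|∇u(t)|²_F` (tree `leray_blowup_rate_enstrophy`, sub-slab boundedness from
`BlowupEnstrophyUnbounded.eLpNorm_uncurry_top_lt_top`) and `∫|∇u|²_F ≤ ∫|curl u|²`.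
[cite: RobinsonRodrigoSadowski2016, Lemma 6.13] -/
theorem lintegral_curl_sq_pos {ν T : ℝ} (hν : 0 < ν) (hT : 0 < T)
    {u : ℝ → EuclideanSpace ℝ (Fin 3) → EuclideanSpace ℝ (Fin 3)} {p : ℝ → EuclideanSpace ℝ (Fin 3) → ℝ}
    (hmax : IsMaximalSmoothSolution ν 0 u p T) (hLH : IsLerayHopfOn T ν 0 (u 0) u)
    (hdec : HasRapidSpatialDecay (u 0)) :
    ∀ t ∈ Ico 0 T, 0 < ∫⁻ x, ‖curl (u t) x‖ₑ ^ 2 := by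
  intro t ht
  have hsol := hmax.isClassicalNSSolutionOn
  obtain ⟨c, hc, hrate⟩ := leray_blowup_rate_enstrophy
  have hfloor := hrate ν T hν hT u p hmax hLH
    (BlowupEnstrophyUnbounded.eLpNorm_uncurry_top_lt_top hν hT hsol hLH hdec) t ht
  have hL2 : ∫⁻ x, ‖u t x‖ₑ ^ 2 < ⊤ :=
    (hLH.lintegral_enorm_sq_le hν.le ⟨ht.1, ht.2.le⟩).trans_lt ENNReal.ofReal_lt_top
  have hcurl := lintegral_frobeniusNormSq_fderiv_le_lintegral_sq_norm_curl
    ((hsol.contDiff_velocity ht).of_le (by norm_cast)) (hsol.divFree t ht) hL2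
  have hTt : 0 < T - t := sub_pos.2 ht.2
  have hpos : 0 < c * ν ^ (3 / 2 : ℝ) * (T - t) ^ (-(1 / 2 : ℝ)) :=
    mul_pos (mul_pos hc (Real.rpow_pos_of_pos hν _)) (Real.rpow_pos_of_pos hTt _)
  exact (ENNReal.ofReal_pos.2 hpos).trans_le (hfloor.trans hcurl)

/-- **The sharp one-sided Lu–Doering constant is unique**: two constants that are positive, admissible and minimal among
admissible constants (the clause of the route decls) coincide. [folklore] -/
theorem sharp_const_unique {c c' : ℝ}
    (hc : (0 < c ∧ (∀ v : EuclideanSpace ℝ (Fin 3) → EuclideanSpace ℝ (Fin 3), (ContDiff ℝ (⊤ : ℕ∞) v ∧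
      Literature.Analysis.FluidPDE.VectorCalculus.IsDivFree v ∧ (∫⁻ x, ‖iteratedFDeriv ℝ 0 v x‖ₑ ^ 2 < ⊤) ∧ (∫⁻ x,
      ‖iteratedFDeriv ℝ 1 v x‖ₑ ^ 2 < ⊤) ∧ (∫⁻ x, ‖iteratedFDeriv ℝ 2 v x‖ₑ ^ 2 < ⊤)) → (∫ x,
      ⟪Literature.Analysis.FluidPDE.curl v x, fderiv ℝ v x (Literature.Analysis.FluidPDE.curl v x)⟫_ℝ) ≤ c * (∫ x,
      ‖Literature.Analysis.FluidPDE.curl v x‖ ^ 2) ^ (3 / 4 : ℝ) * (∫ x,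
      Literature.Analysis.FluidPDE.frobeniusNormSq (fderiv ℝ (Literature.Analysis.FluidPDE.curl v) x)) ^ (3 / 4 :
      ℝ)) ∧ ∀ c' : ℝ, (∀ w : EuclideanSpace ℝ (Fin 3) → EuclideanSpace ℝ (Fin 3), (ContDiff ℝ (⊤ : ℕ∞) w ∧
      Literature.Analysis.FluidPDE.VectorCalculus.IsDivFree w ∧ (∫⁻ x, ‖iteratedFDeriv ℝ 0 w x‖ₑ ^ 2 < ⊤) ∧ (∫⁻ x,
      ‖iteratedFDeriv ℝ 1 w x‖ₑ ^ 2 < ⊤) ∧ (∫⁻ x, ‖iteratedFDeriv ℝ 2 w x‖ₑ ^ 2 < ⊤)) → (∫ x,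
      ⟪Literature.Analysis.FluidPDE.curl w x, fderiv ℝ w x (Literature.Analysis.FluidPDE.curl w x)⟫_ℝ) ≤ c' * (∫
      x, ‖Literature.Analysis.FluidPDE.curl w x‖ ^ 2) ^ (3 / 4 : ℝ) * (∫ x,
      Literature.Analysis.FluidPDE.frobeniusNormSq (fderiv ℝ (Literature.Analysis.FluidPDE.curl w) x)) ^ (3 / 4 :
      ℝ)) → c ≤ c'))
    (hc' : (0 < c' ∧ (∀ v : EuclideanSpace ℝ (Fin 3) → EuclideanSpace ℝ (Fin 3), (ContDiff ℝ (⊤ : ℕ∞) v ∧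
      Literature.Analysis.FluidPDE.VectorCalculus.IsDivFree v ∧ (∫⁻ x, ‖iteratedFDeriv ℝ 0 v x‖ₑ ^ 2 < ⊤) ∧ (∫⁻ x,
      ‖iteratedFDeriv ℝ 1 v x‖ₑ ^ 2 < ⊤) ∧ (∫⁻ x, ‖iteratedFDeriv ℝ 2 v x‖ₑ ^ 2 < ⊤)) → (∫ x,
      ⟪Literature.Analysis.FluidPDE.curl v x, fderiv ℝ v x (Literature.Analysis.FluidPDE.curl v x)⟫_ℝ) ≤ c' * (∫
      x, ‖Literature.Analysis.FluidPDE.curl v x‖ ^ 2) ^ (3 / 4 : ℝ) * (∫ x,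
      Literature.Analysis.FluidPDE.frobeniusNormSq (fderiv ℝ (Literature.Analysis.FluidPDE.curl v) x)) ^ (3 / 4 :
      ℝ)) ∧ ∀ c'' : ℝ, (∀ w : EuclideanSpace ℝ (Fin 3) → EuclideanSpace ℝ (Fin 3), (ContDiff ℝ (⊤ : ℕ∞) w ∧
      Literature.Analysis.FluidPDE.VectorCalculus.IsDivFree w ∧ (∫⁻ x, ‖iteratedFDeriv ℝ 0 w x‖ₑ ^ 2 < ⊤) ∧ (∫⁻ x,
      ‖iteratedFDeriv ℝ 1 w x‖ₑ ^ 2 < ⊤) ∧ (∫⁻ x, ‖iteratedFDeriv ℝ 2 w x‖ₑ ^ 2 < ⊤)) → (∫ x,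
      ⟪Literature.Analysis.FluidPDE.curl w x, fderiv ℝ w x (Literature.Analysis.FluidPDE.curl w x)⟫_ℝ) ≤ c'' * (∫
      x, ‖Literature.Analysis.FluidPDE.curl w x‖ ^ 2) ^ (3 / 4 : ℝ) * (∫ x,
      Literature.Analysis.FluidPDE.frobeniusNormSq (fderiv ℝ (Literature.Analysis.FluidPDE.curl w) x)) ^ (3 / 4 :
      ℝ)) → c' ≤ c'')) :
    c = c' :=
  le_antisymm (hc.2.2 c' hc'.2.1) (hc'.2.2 c hc.2.1)

/-! ## The equivalence, BY NAME -/

/-- **Early deficit ⟹ `NearMaximiserBoundedAmplification`.** If for the sharp constant there are `0 ≤ η < 1`, `θ > 0`,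
`ε > 0` such that every slice `u(s)` that is `ε`-close to a normalised maximiser is followed, at the instant
`s' = s + η·W(s)` (`W(s) = (64ν³/(27c⁴))·Z(u(s))⁻²`), by `s' < T` and `Z(u(s'))⁻² ≥ (1 − η + 2θ)·Z(u(s))⁻²`, then the route
decl holds with `A = √max((1−η)⁻¹,(2θ)⁻¹)` and the same `ε`. [folklore] -/
theorem nearMaximiserBoundedAmplification_of_earlyDeficit
    (hED : ∀ c : ℝ, (0 < c ∧ (∀ v : EuclideanSpace ℝ (Fin 3) → EuclideanSpace ℝ (Fin 3), (ContDiff ℝ (⊤ : ℕ∞) v ∧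
      Literature.Analysis.FluidPDE.VectorCalculus.IsDivFree v ∧ (∫⁻ x, ‖iteratedFDeriv ℝ 0 v x‖ₑ ^ 2 < ⊤) ∧ (∫⁻ x,
      ‖iteratedFDeriv ℝ 1 v x‖ₑ ^ 2 < ⊤) ∧ (∫⁻ x, ‖iteratedFDeriv ℝ 2 v x‖ₑ ^ 2 < ⊤)) → (∫ x,
      ⟪Literature.Analysis.FluidPDE.curl v x, fderiv ℝ v x (Literature.Analysis.FluidPDE.curl v x)⟫_ℝ) ≤ c * (∫ x,
      ‖Literature.Analysis.FluidPDE.curl v x‖ ^ 2) ^ (3 / 4 : ℝ) * (∫ x,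
      Literature.Analysis.FluidPDE.frobeniusNormSq (fderiv ℝ (Literature.Analysis.FluidPDE.curl v) x)) ^ (3 / 4 :
      ℝ)) ∧ ∀ c' : ℝ, (∀ w : EuclideanSpace ℝ (Fin 3) → EuclideanSpace ℝ (Fin 3), (ContDiff ℝ (⊤ : ℕ∞) w ∧
      Literature.Analysis.FluidPDE.VectorCalculus.IsDivFree w ∧ (∫⁻ x, ‖iteratedFDeriv ℝ 0 w x‖ₑ ^ 2 < ⊤) ∧ (∫⁻ x,
      ‖iteratedFDeriv ℝ 1 w x‖ₑ ^ 2 < ⊤) ∧ (∫⁻ x, ‖iteratedFDeriv ℝ 2 w x‖ₑ ^ 2 < ⊤)) → (∫ x,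
      ⟪Literature.Analysis.FluidPDE.curl w x, fderiv ℝ w x (Literature.Analysis.FluidPDE.curl w x)⟫_ℝ) ≤ c' * (∫
      x, ‖Literature.Analysis.FluidPDE.curl w x‖ ^ 2) ^ (3 / 4 : ℝ) * (∫ x,
      Literature.Analysis.FluidPDE.frobeniusNormSq (fderiv ℝ (Literature.Analysis.FluidPDE.curl w) x)) ^ (3 / 4 :
      ℝ)) → c ≤ c') → ∃ η θ ε : ℝ, 0 ≤ η ∧ η < 1 ∧ 0 < θ ∧ 0 < ε ∧ ∀ (ν T : ℝ), 0 < ν → 0 < T → ∀ (u : ℝ →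
      EuclideanSpace ℝ (Fin 3) → EuclideanSpace ℝ (Fin 3)) (p : ℝ → EuclideanSpace ℝ (Fin 3) → ℝ),
      Literature.Analysis.FluidPDE.IsMaximalSmoothSolution ν 0 u p T → Literature.Analysis.FluidPDE.IsLerayHopfOn
      T ν 0 (u 0) u → Literature.Analysis.FluidPDE.HasRapidSpatialDecay (u 0) → ∀ s ∈ Set.Ioo 0 T, ∀ m :
      EuclideanSpace ℝ (Fin 3) → EuclideanSpace ℝ (Fin 3), ((ContDiff ℝ (⊤ : ℕ∞) m ∧
      Literature.Analysis.FluidPDE.VectorCalculus.IsDivFree m ∧ (∫⁻ x, ‖iteratedFDeriv ℝ 0 m x‖ₑ ^ 2 < ⊤) ∧ (∫⁻ x,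
      ‖iteratedFDeriv ℝ 1 m x‖ₑ ^ 2 < ⊤) ∧ (∫⁻ x, ‖iteratedFDeriv ℝ 2 m x‖ₑ ^ 2 < ⊤)) ∧ 0 < (∫ x,
      ‖Literature.Analysis.FluidPDE.curl m x‖ ^ 2) ∧ (∫ x, ⟪Literature.Analysis.FluidPDE.curl m x, fderiv ℝ m x
      (Literature.Analysis.FluidPDE.curl m x)⟫_ℝ) = c * (∫ x, ‖Literature.Analysis.FluidPDE.curl m x‖ ^ 2) ^ (3 /
      4 : ℝ) * (∫ x, Literature.Analysis.FluidPDE.frobeniusNormSq (fderiv ℝ (Literature.Analysis.FluidPDE.curl m)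
      x)) ^ (3 / 4 : ℝ) ∧ (∫ x, Literature.Analysis.FluidPDE.frobeniusNormSq (fderiv ℝ
      (Literature.Analysis.FluidPDE.curl m) x)) = 81 * c ^ 4 / (256 * ν ^ 4) * (∫ x,
      ‖Literature.Analysis.FluidPDE.curl m x‖ ^ 2) ^ 3) → ((∫ x, ‖Literature.Analysis.FluidPDE.curl (u s - m) x‖ ^
      2) ≤ ε ^ 2 * (∫ x, ‖Literature.Analysis.FluidPDE.curl (u s) x‖ ^ 2) ∧ (∫ x,
      Literature.Analysis.FluidPDE.frobeniusNormSq (fderiv ℝ (Literature.Analysis.FluidPDE.curl (u s - m)) x)) ≤ ε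
      ^ 2 * (∫ x, Literature.Analysis.FluidPDE.frobeniusNormSq (fderiv ℝ (Literature.Analysis.FluidPDE.curl (u s))
      x))) → s + η * (64 * ν ^ 3 / (27 * c ^ 4) * (∫ x, ‖Literature.Analysis.FluidPDE.curl (u s) x‖ ^ 2)⁻¹ ^ 2) <
      T ∧ (1 - η + 2 * θ) * (∫ x, ‖Literature.Analysis.FluidPDE.curl (u s) x‖ ^ 2)⁻¹ ^ 2 ≤ (∫ x,
      ‖Literature.Analysis.FluidPDE.curl (u (s + η * (64 * ν ^ 3 / (27 * c ^ 4) * (∫ x,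
      ‖Literature.Analysis.FluidPDE.curl (u s) x‖ ^ 2)⁻¹ ^ 2))) x‖ ^ 2)⁻¹ ^ 2) :
    Summit.NavierStokesRegularity.NavierStokesRegularity.Theses.EfficiencyFloor.NearMaximiserBoundedAmplification := by
  intro c hsharp
  obtain ⟨η, θ, ε, hη0, hη1, hθ, hε, hlaw⟩ := hED c hsharp
  obtain ⟨c₀, hsharp₀, hbud⟩ := efficiencyFloor_sharpLuDoeringBudget_proof
  have hcc : c₀ = c := sharp_const_unique hsharp₀ hsharp
  have hc : 0 < c := hsharp.1
  have h1η : 0 < 1 - η := by linarith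
  have hM1 : 1 ≤ max (1 - η)⁻¹ (2 * θ)⁻¹ :=
    le_max_of_le_left (one_le_inv_iff₀.2 ⟨h1η, by linarith⟩)
  have hM0 : 0 ≤ max (1 - η)⁻¹ (2 * θ)⁻¹ := zero_le_one.trans hM1
  set A : ℝ := Real.sqrt (max (1 - η)⁻¹ (2 * θ)⁻¹) with hA
  have hA1 : 1 ≤ A := by rw [hA]; exact Real.one_le_sqrt.2 hM1
  have hA0 : 0 ≤ A := zero_le_one.trans hA1
  have hA2 : A ^ 2 = max (1 - η)⁻¹ (2 * θ)⁻¹ := by rw [hA]; exact Real.sq_sqrt hM0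
  refine ⟨A, ε, hA1, hε, fun ν T hν hT u p hmax hLH hdec s hs m hm hclose t ht hwin => ?_⟩
  obtain ⟨Zr, D, hZD⟩ := hbud ν T hν hT u p hmax hLH hdec
  obtain ⟨hs'T, hdef⟩ := hlaw ν T hν hT u p hmax hLH hdec s hs m hm hclose
  set K : ℝ := 27 * c ^ 4 / (128 * ν ^ 3) with hK
  have hKpos : 0 < K := by positivity
  have he : 64 * ν ^ 3 / (27 * c ^ 4) = (2 * K)⁻¹ := by
    rw [hK]; field_simp; norm_num
  -- positivity and the cubic law for the real enstrophy `Zr` on `[s, T)`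
  have hpos : ∀ τ ∈ Ico s T, 0 < Zr τ := fun τ hτ => by
    have hτI : τ ∈ Ioo 0 T := ⟨hs.1.trans_le hτ.1, hτ.2⟩
    have h1 := lintegral_curl_sq_pos hν hT hmax hLH hdec τ ⟨hτI.1.le, hτI.2⟩
    rw [(hZD τ hτI).1] at h1
    exact ENNReal.ofReal_pos.1 h1
  have hder : ∀ τ ∈ Ico s T, ∃ D' : ℝ, HasDerivAt Zr D' τ ∧ D' ≤ K * Zr τ ^ 3 := fun τ hτ => by
    have hτI : τ ∈ Ioo 0 T := ⟨hs.1.trans_le hτ.1, hτ.2⟩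
    refine ⟨D τ, (hZD τ hτI).2.2.2.2.1, ?_⟩
    have h3 := (hZD τ hτI).2.2.2.2.2.2
    rw [hcc] at h3
    rw [hK]; exact h3
  -- the slices' enstrophies are values of `Zr`
  have htI : t ∈ Ioo 0 T := ⟨hs.1.trans_le ht.1, ht.2⟩
  have hZs : (∫ x, ‖curl (u s) x‖ ^ 2) = Zr s := ((hZD s hs).2.2.2.1).symm
  have hZt : (∫ x, ‖curl (u t) x‖ ^ 2) = Zr t := ((hZD t htI).2.2.2.1).symm
  rw [hZs, he] at hwin hs'T hdef
  have hW0 : 0 ≤ η * ((2 * K)⁻¹ * (Zr s)⁻¹ ^ 2) := by positivity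
  have hs'I : s + η * ((2 * K)⁻¹ * (Zr s)⁻¹ ^ 2) ∈ Ioo 0 T := ⟨by linarith [hs.1], hs'T⟩
  have hZs' : (∫ x, ‖curl (u (s + η * ((2 * K)⁻¹ * (Zr s)⁻¹ ^ 2))) x‖ ^ 2) =
      Zr (s + η * ((2 * K)⁻¹ * (Zr s)⁻¹ ^ 2)) := ((hZD _ hs'I).2.2.2.1).symm
  rw [hZs'] at hdef
  rw [hZs, hZt]
  have hsq := sq_le_of_earlyDeficit hKpos hη0 hη1 hθ hpos hder le_rfl hdef ht.1 ht.2 hwin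
  rw [← hA2, ← mul_pow] at hsq
  have hZt0 : 0 ≤ Zr t := (hpos t ⟨ht.1, ht.2⟩).le
  have hAZ : 0 ≤ A * Zr s := mul_nonneg hA0 (hpos s ⟨le_rfl, hs.2⟩).le
  exact (pow_le_pow_iff_left₀ hZt0 hAZ two_ne_zero).1 hsq

/-- **`NearMaximiserBoundedAmplification` ⟹ early deficit.** If the route decl holds with `(A, ε)`, then the early-deficit law
holds with `η = 1 − A⁻²/2`, `θ = A⁻²/4` and the same `ε`: window survival `s + W(s) < T` comes from `Z(u(t)) → ∞` as `t ↑ T`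
(`BlowupEnstrophyUnbounded`, stmt-22867) against the bound `Z ≤ A·Z(u(s))` on the window, and at `s' = s + ηW(s)` the bound
`Z(u(s')) ≤ A·Z(u(s))` is the margin `A⁻²·Z(u(s))⁻² ≤ Z(u(s'))⁻²`. [folklore] -/
theorem earlyDeficit_of_nearMaximiserBoundedAmplification
    (hN : Summit.NavierStokesRegularity.NavierStokesRegularity.Theses.EfficiencyFloor.NearMaximiserBoundedAmplification) :
    ∀ c : ℝ, (0 < c ∧ (∀ v : EuclideanSpace ℝ (Fin 3) → EuclideanSpace ℝ (Fin 3), (ContDiff ℝ (⊤ : ℕ∞) v ∧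
      Literature.Analysis.FluidPDE.VectorCalculus.IsDivFree v ∧ (∫⁻ x, ‖iteratedFDeriv ℝ 0 v x‖ₑ ^ 2 < ⊤) ∧ (∫⁻ x,
      ‖iteratedFDeriv ℝ 1 v x‖ₑ ^ 2 < ⊤) ∧ (∫⁻ x, ‖iteratedFDeriv ℝ 2 v x‖ₑ ^ 2 < ⊤)) → (∫ x,
      ⟪Literature.Analysis.FluidPDE.curl v x, fderiv ℝ v x (Literature.Analysis.FluidPDE.curl v x)⟫_ℝ) ≤ c * (∫ x,
      ‖Literature.Analysis.FluidPDE.curl v x‖ ^ 2) ^ (3 / 4 : ℝ) * (∫ x,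
      Literature.Analysis.FluidPDE.frobeniusNormSq (fderiv ℝ (Literature.Analysis.FluidPDE.curl v) x)) ^ (3 / 4 :
      ℝ)) ∧ ∀ c' : ℝ, (∀ w : EuclideanSpace ℝ (Fin 3) → EuclideanSpace ℝ (Fin 3), (ContDiff ℝ (⊤ : ℕ∞) w ∧
      Literature.Analysis.FluidPDE.VectorCalculus.IsDivFree w ∧ (∫⁻ x, ‖iteratedFDeriv ℝ 0 w x‖ₑ ^ 2 < ⊤) ∧ (∫⁻ x,
      ‖iteratedFDeriv ℝ 1 w x‖ₑ ^ 2 < ⊤) ∧ (∫⁻ x, ‖iteratedFDeriv ℝ 2 w x‖ₑ ^ 2 < ⊤)) → (∫ x,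
      ⟪Literature.Analysis.FluidPDE.curl w x, fderiv ℝ w x (Literature.Analysis.FluidPDE.curl w x)⟫_ℝ) ≤ c' * (∫
      x, ‖Literature.Analysis.FluidPDE.curl w x‖ ^ 2) ^ (3 / 4 : ℝ) * (∫ x,
      Literature.Analysis.FluidPDE.frobeniusNormSq (fderiv ℝ (Literature.Analysis.FluidPDE.curl w) x)) ^ (3 / 4 :
      ℝ)) → c ≤ c') → ∃ η θ ε : ℝ, 0 ≤ η ∧ η < 1 ∧ 0 < θ ∧ 0 < ε ∧ ∀ (ν T : ℝ), 0 < ν → 0 < T → ∀ (u : ℝ →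
      EuclideanSpace ℝ (Fin 3) → EuclideanSpace ℝ (Fin 3)) (p : ℝ → EuclideanSpace ℝ (Fin 3) → ℝ),
      Literature.Analysis.FluidPDE.IsMaximalSmoothSolution ν 0 u p T → Literature.Analysis.FluidPDE.IsLerayHopfOn
      T ν 0 (u 0) u → Literature.Analysis.FluidPDE.HasRapidSpatialDecay (u 0) → ∀ s ∈ Set.Ioo 0 T, ∀ m :
      EuclideanSpace ℝ (Fin 3) → EuclideanSpace ℝ (Fin 3), ((ContDiff ℝ (⊤ : ℕ∞) m ∧
      Literature.Analysis.FluidPDE.VectorCalculus.IsDivFree m ∧ (∫⁻ x, ‖iteratedFDeriv ℝ 0 m x‖ₑ ^ 2 < ⊤) ∧ (∫⁻ x,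
      ‖iteratedFDeriv ℝ 1 m x‖ₑ ^ 2 < ⊤) ∧ (∫⁻ x, ‖iteratedFDeriv ℝ 2 m x‖ₑ ^ 2 < ⊤)) ∧ 0 < (∫ x,
      ‖Literature.Analysis.FluidPDE.curl m x‖ ^ 2) ∧ (∫ x, ⟪Literature.Analysis.FluidPDE.curl m x, fderiv ℝ m x
      (Literature.Analysis.FluidPDE.curl m x)⟫_ℝ) = c * (∫ x, ‖Literature.Analysis.FluidPDE.curl m x‖ ^ 2) ^ (3 /
      4 : ℝ) * (∫ x, Literature.Analysis.FluidPDE.frobeniusNormSq (fderiv ℝ (Literature.Analysis.FluidPDE.curl m)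
      x)) ^ (3 / 4 : ℝ) ∧ (∫ x, Literature.Analysis.FluidPDE.frobeniusNormSq (fderiv ℝ
      (Literature.Analysis.FluidPDE.curl m) x)) = 81 * c ^ 4 / (256 * ν ^ 4) * (∫ x,
      ‖Literature.Analysis.FluidPDE.curl m x‖ ^ 2) ^ 3) → ((∫ x, ‖Literature.Analysis.FluidPDE.curl (u s - m) x‖ ^
      2) ≤ ε ^ 2 * (∫ x, ‖Literature.Analysis.FluidPDE.curl (u s) x‖ ^ 2) ∧ (∫ x,
      Literature.Analysis.FluidPDE.frobeniusNormSq (fderiv ℝ (Literature.Analysis.FluidPDE.curl (u s - m)) x)) ≤ ε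
      ^ 2 * (∫ x, Literature.Analysis.FluidPDE.frobeniusNormSq (fderiv ℝ (Literature.Analysis.FluidPDE.curl (u s))
      x))) → s + η * (64 * ν ^ 3 / (27 * c ^ 4) * (∫ x, ‖Literature.Analysis.FluidPDE.curl (u s) x‖ ^ 2)⁻¹ ^ 2) <
      T ∧ (1 - η + 2 * θ) * (∫ x, ‖Literature.Analysis.FluidPDE.curl (u s) x‖ ^ 2)⁻¹ ^ 2 ≤ (∫ x,
      ‖Literature.Analysis.FluidPDE.curl (u (s + η * (64 * ν ^ 3 / (27 * c ^ 4) * (∫ x,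
      ‖Literature.Analysis.FluidPDE.curl (u s) x‖ ^ 2)⁻¹ ^ 2))) x‖ ^ 2)⁻¹ ^ 2 := by
  intro c hsharp
  obtain ⟨A, ε, hA, hε, hlaw⟩ := hN c hsharp
  have hA0 : 0 < A := lt_of_lt_of_le one_pos hA
  have hA2 : 1 ≤ A ^ 2 := by nlinarith
  have hAi1 : (A ^ 2)⁻¹ ≤ 1 := inv_le_one_of_one_le₀ hA2
  have hAi0 : 0 < (A ^ 2)⁻¹ := by positivity
  refine ⟨1 - (A ^ 2)⁻¹ / 2, (A ^ 2)⁻¹ / 4, ε, by linarith, by linarith, by positivity, hε,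
    fun ν T hν hT u p hmax hLH hdec s hs m hm hclose => ?_⟩
  obtain ⟨c₀, hsharp₀, hbud⟩ := efficiencyFloor_sharpLuDoeringBudget_proof
  obtain ⟨Zr, D, hZD⟩ := hbud ν T hν hT u p hmax hLH hdec
  have hc : 0 < c := hsharp.1
  have hlawu := hlaw ν T hν hT u p hmax hLH hdec s hs m hm hclose
  set W : ℝ := 64 * ν ^ 3 / (27 * c ^ 4) * (∫ x, ‖curl (u s) x‖ ^ 2)⁻¹ ^ 2 with hW
  have hW0 : 0 ≤ W := by positivity
  -- real enstrophy values and their positivity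
  have hZof : ∀ τ ∈ Ioo 0 T, (∫ x, ‖curl (u τ) x‖ ^ 2) = Zr τ := fun τ hτ => ((hZD τ hτ).2.2.2.1).symm
  have hpos : ∀ τ ∈ Ioo 0 T, 0 < Zr τ := fun τ hτ => by
    have h1 := lintegral_curl_sq_pos hν hT hmax hLH hdec τ ⟨hτ.1.le, hτ.2⟩
    rw [(hZD τ hτ).1] at h1
    exact ENNReal.ofReal_pos.1 h1
  have hZs0 : 0 < Zr s := hpos s hs
  -- (1) the whole window lies before `T`
  have hsurv : s + W < T := by
    by_contra hle
    rw [not_lt] at hle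
    have hU := BlowupEnstrophyUnbounded.main hν hT hmax hLH hdec (A * Zr s + 1)
    have hnear : ∀ᶠ t in 𝓝[<] T, t ∈ Ioo s T := Ioo_mem_nhdsLT hs.2
    obtain ⟨t, hNt, ht⟩ := (hU.and hnear).exists
    have htI : t ∈ Ioo 0 T := ⟨hs.1.trans ht.1, ht.2⟩
    have hwin : t - s ≤ W := by linarith [ht.2]
    have hbd := hlawu t ⟨ht.1.le, ht.2⟩ hwin
    rw [hZof t htI, hZof s hs] at hbd
    rw [(hZD t htI).1, ENNReal.ofReal_le_ofReal_iff (hZD t htI).2.1] at hNt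
    linarith
  -- (2) the early instant `s' = s + ηW`
  have hηW : (1 - (A ^ 2)⁻¹ / 2) * W ≤ W := by nlinarith
  have hs'T : s + (1 - (A ^ 2)⁻¹ / 2) * W < T := by linarith
  refine ⟨hs'T, ?_⟩
  have hηW0 : 0 ≤ (1 - (A ^ 2)⁻¹ / 2) * W := mul_nonneg (by linarith) hW0
  have hs'I : s + (1 - (A ^ 2)⁻¹ / 2) * W ∈ Ioo 0 T := ⟨by linarith [hs.1], hs'T⟩
  have hbd := hlawu (s + (1 - (A ^ 2)⁻¹ / 2) * W) ⟨by linarith, hs'T⟩ (by linarith)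
  rw [hZof _ hs'I, hZof s hs] at hbd
  rw [hZof _ hs'I, hZof s hs]
  have hZs'0 : 0 < Zr (s + (1 - (A ^ 2)⁻¹ / 2) * W) := hpos _ hs'I
  have hcoef : 1 - (1 - (A ^ 2)⁻¹ / 2) + 2 * ((A ^ 2)⁻¹ / 4) = (A ^ 2)⁻¹ := by ring
  rw [hcoef, inv_pow, inv_pow, ← mul_inv, ← mul_pow]
  exact inv_anti₀ (pow_pos hZs'0 2) (pow_le_pow_left₀ hZs'0.le hbd 2)

/-- **stmt-NavierStokesRegularity-25483 ⟺ the early-deficit law** (BY NAME against the route decl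
`Theses.EfficiencyFloor.NearMaximiserBoundedAmplification`). [folklore] -/
theorem nearMaximiserBoundedAmplification_iff_earlyDeficit :
    Summit.NavierStokesRegularity.NavierStokesRegularity.Theses.EfficiencyFloor.NearMaximiserBoundedAmplification ↔
      (∀ c : ℝ, (0 < c ∧ (∀ v : EuclideanSpace ℝ (Fin 3) → EuclideanSpace ℝ (Fin 3), (ContDiff ℝ (⊤ : ℕ∞) v ∧
        Literature.Analysis.FluidPDE.VectorCalculus.IsDivFree v ∧ (∫⁻ x, ‖iteratedFDeriv ℝ 0 v x‖ₑ ^ 2 < ⊤) ∧ (∫⁻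
        x, ‖iteratedFDeriv ℝ 1 v x‖ₑ ^ 2 < ⊤) ∧ (∫⁻ x, ‖iteratedFDeriv ℝ 2 v x‖ₑ ^ 2 < ⊤)) → (∫ x,
        ⟪Literature.Analysis.FluidPDE.curl v x, fderiv ℝ v x (Literature.Analysis.FluidPDE.curl v x)⟫_ℝ) ≤ c * (∫
        x, ‖Literature.Analysis.FluidPDE.curl v x‖ ^ 2) ^ (3 / 4 : ℝ) * (∫ x,
        Literature.Analysis.FluidPDE.frobeniusNormSq (fderiv ℝ (Literature.Analysis.FluidPDE.curl v) x)) ^ (3 / 4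
        : ℝ)) ∧ ∀ c' : ℝ, (∀ w : EuclideanSpace ℝ (Fin 3) → EuclideanSpace ℝ (Fin 3), (ContDiff ℝ (⊤ : ℕ∞) w ∧
        Literature.Analysis.FluidPDE.VectorCalculus.IsDivFree w ∧ (∫⁻ x, ‖iteratedFDeriv ℝ 0 w x‖ₑ ^ 2 < ⊤) ∧ (∫⁻
        x, ‖iteratedFDeriv ℝ 1 w x‖ₑ ^ 2 < ⊤) ∧ (∫⁻ x, ‖iteratedFDeriv ℝ 2 w x‖ₑ ^ 2 < ⊤)) → (∫ x,
        ⟪Literature.Analysis.FluidPDE.curl w x, fderiv ℝ w x (Literature.Analysis.FluidPDE.curl w x)⟫_ℝ) ≤ c' * (∫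
        x, ‖Literature.Analysis.FluidPDE.curl w x‖ ^ 2) ^ (3 / 4 : ℝ) * (∫ x,
        Literature.Analysis.FluidPDE.frobeniusNormSq (fderiv ℝ (Literature.Analysis.FluidPDE.curl w) x)) ^ (3 / 4
        : ℝ)) → c ≤ c') → ∃ η θ ε : ℝ, 0 ≤ η ∧ η < 1 ∧ 0 < θ ∧ 0 < ε ∧ ∀ (ν T : ℝ), 0 < ν → 0 < T → ∀ (u : ℝ →
        EuclideanSpace ℝ (Fin 3) → EuclideanSpace ℝ (Fin 3)) (p : ℝ → EuclideanSpace ℝ (Fin 3) → ℝ),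
        Literature.Analysis.FluidPDE.IsMaximalSmoothSolution ν 0 u p T →
        Literature.Analysis.FluidPDE.IsLerayHopfOn T ν 0 (u 0) u →
        Literature.Analysis.FluidPDE.HasRapidSpatialDecay (u 0) → ∀ s ∈ Set.Ioo 0 T, ∀ m : EuclideanSpace ℝ (Fin
        3) → EuclideanSpace ℝ (Fin 3), ((ContDiff ℝ (⊤ : ℕ∞) m ∧
        Literature.Analysis.FluidPDE.VectorCalculus.IsDivFree m ∧ (∫⁻ x, ‖iteratedFDeriv ℝ 0 m x‖ₑ ^ 2 < ⊤) ∧ (∫⁻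
        x, ‖iteratedFDeriv ℝ 1 m x‖ₑ ^ 2 < ⊤) ∧ (∫⁻ x, ‖iteratedFDeriv ℝ 2 m x‖ₑ ^ 2 < ⊤)) ∧ 0 < (∫ x,
        ‖Literature.Analysis.FluidPDE.curl m x‖ ^ 2) ∧ (∫ x, ⟪Literature.Analysis.FluidPDE.curl m x, fderiv ℝ m x
        (Literature.Analysis.FluidPDE.curl m x)⟫_ℝ) = c * (∫ x, ‖Literature.Analysis.FluidPDE.curl m x‖ ^ 2) ^ (3
        / 4 : ℝ) * (∫ x, Literature.Analysis.FluidPDE.frobeniusNormSq (fderiv ℝ (Literature.Analysis.FluidPDE.curl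
        m) x)) ^ (3 / 4 : ℝ) ∧ (∫ x, Literature.Analysis.FluidPDE.frobeniusNormSq (fderiv ℝ
        (Literature.Analysis.FluidPDE.curl m) x)) = 81 * c ^ 4 / (256 * ν ^ 4) * (∫ x,
        ‖Literature.Analysis.FluidPDE.curl m x‖ ^ 2) ^ 3) → ((∫ x, ‖Literature.Analysis.FluidPDE.curl (u s - m) x‖
        ^ 2) ≤ ε ^ 2 * (∫ x, ‖Literature.Analysis.FluidPDE.curl (u s) x‖ ^ 2) ∧ (∫ x,
        Literature.Analysis.FluidPDE.frobeniusNormSq (fderiv ℝ (Literature.Analysis.FluidPDE.curl (u s - m)) x)) ≤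
        ε ^ 2 * (∫ x, Literature.Analysis.FluidPDE.frobeniusNormSq (fderiv ℝ (Literature.Analysis.FluidPDE.curl (u
        s)) x))) → s + η * (64 * ν ^ 3 / (27 * c ^ 4) * (∫ x, ‖Literature.Analysis.FluidPDE.curl (u s) x‖ ^ 2)⁻¹ ^
        2) < T ∧ (1 - η + 2 * θ) * (∫ x, ‖Literature.Analysis.FluidPDE.curl (u s) x‖ ^ 2)⁻¹ ^ 2 ≤ (∫ x,
        ‖Literature.Analysis.FluidPDE.curl (u (s + η * (64 * ν ^ 3 / (27 * c ^ 4) * (∫ x,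
        ‖Literature.Analysis.FluidPDE.curl (u s) x‖ ^ 2)⁻¹ ^ 2))) x‖ ^ 2)⁻¹ ^ 2) :=
  ⟨earlyDeficit_of_nearMaximiserBoundedAmplification, nearMaximiserBoundedAmplification_of_earlyDeficit⟩

end NearMaximiserBoundedAmplification

end Summit.NavierStokesRegularity.NavierStokesRegularity.Theorems

end
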